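import Mathlib.Data.Real.Basic
import Mathlib.Tactic.NormNum
import HarnessLib

/-!
# The printed constants of the Chen–Hou computer-assisted blow-up framework (data with locators)

Topic `Literature/Analysis/FluidPDE`. Companion of `ChenHouStabilityLemma.lean` (the proved
stability lemmas) and `ChenHouBlowup.lean` (the blow-up theorem as printed). This file only RECORDS,
as real/natural numbers with their locators, the numerical parameters printed in

* J. Chen, T. Y. Hou, Part I, arXiv:2210.07191 [arXiv221007191], §2.2 Theorem 3 and §2.3
  Lemmas 2.2–2.4;
* Part II, arXiv:2305.05660 [ChenHou2023RigorousNumerics], Theorem 3 and Lemmas 2.3–2.4: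

"Let `(θ̄, ω̄, ū, c̄_l, c̄_ω)` be the approximate self-similar profile … and `E_* = 5·10⁻⁶`. For even
initial data `θ₀` and odd `ω₀` … satisfying `E(ω₀ − ω̄, θ_{0,x} − θ̄_x, θ_{0,y} − θ̄_y) < E_*`, we
have `‖ω − ω̄‖_{L^∞}, ‖θ_x − θ̄_x‖_{L^∞}, ‖θ_y − θ̄_y‖_∞ < 200E_*`, `|u_x(t,0) − ū_x(0)|,
|c̄_ω − c_ω| < 100E_*` for all time"; "finite rank approximations `û, ∇̂u` … with rank less than
50"; "`m < 50` approximate solutions `F̂_i` to the linearized equations".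

WHAT THIS IS NOT: these are parameters of a computer-assisted proof about a numerically computed
profile (data); recording them asserts nothing about Boussinesq/Euler (that is the named fact of
`ChenHouBlowup.lean`) and nothing about Navier–Stokes. The profile exponents `c̄_l ≈ 3.00649898`,
`c̄_ω ≈ −1.02942516` are recorded in `SelfSimilarCollapseAnsatz.lean` (`chenHou_cl`, `chenHou_cω`).
-/

noncomputable section

namespace Literature.Analysis.FluidPDE

/-- **The bootstrap threshold `E_* = 5·10⁻⁶`** of Chen–Hou's Theorem 3 (Part I §2.2; Part II
Theorem 3): "Let `(θ̄, ω̄, ū, c̄_l, c̄_ω)` be the approximate self-similar profile … and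
`E_* = 5·10⁻⁶`. Assume … `E(ω₀ − ω̄, θ_{0,x} − θ̄_x, θ_{0,y} − θ̄_y) < E_*`." A parameter of the
computer-assisted proof (data). [cite: ChenHou2023RigorousNumerics, Theorem 3 (E_* = 5·10⁻⁶)] -/
def chenHou_Estar : ℝ := 5e-6

/-- **The profile-error bound `200 E_*`** in the conclusion of Theorem 3: "`‖ω − ω̄‖_{L^∞},
‖θ_x − θ̄_x‖_{L^∞}, ‖θ_y − θ̄_y‖_∞ < 200E_*` … for all time" (Part I §2.2 Thm 3; Part II Thm 3).
Data. [cite: ChenHou2023RigorousNumerics, Theorem 3 (conclusion, 200E_*)] -/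
def chenHou_profileErrorBound : ℝ := 200 * chenHou_Estar

/-- **The exponent-error bound `100 E_*`** in the conclusion of Theorem 3:
"`|u_x(t,0) − ū_x(0)|, |c̄_ω − c_ω| < 100E_*` for all time" (Part I §2.2 Thm 3; Part II Thm 3). Data.
[cite: ChenHou2023RigorousNumerics, Theorem 3 (conclusion, 100E_*)] -/
def chenHou_exponentErrorBound : ℝ := 100 * chenHou_Estar

/-- **The finite-rank bound `50`**: "finite rank approximations `û, ∇̂u` for `u(ω), ∇u(ω)` with
rank less than 50" (Part I Lemma 2.2 = Part II Lemma 2.3) and "`m < 50` approximate solutions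
`F̂_i` to the linearized equations" (Part I Lemma 2.3 = Part II Lemma 2.4): the rank of the
finite-rank perturbation `𝒦` of the linearised operator. Data. [cite: ChenHou2023RigorousNumerics, Lemmas 2.3–2.4 (rank less than 50)] -/
def chenHou_rankBound : ℕ := 50

/-- Numerical values: `E_* = 5·10⁻⁶`, `200E_* = 10⁻³`, `100E_* = 5·10⁻⁴`; in particular the
perturbation of the exponent `c_ω` allowed by Theorem 3 is `< 5·10⁻⁴ ≪ |c̄_ω| ≈ 1.03`, so the sign
condition `c̄_ω + c_ω < −1/2` of Part I §6.5 is insensitive to it. [cite: ChenHou2023RigorousNumerics, Theorem 3 (constants)] -/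
theorem chenHou_constants_eval :
    chenHou_Estar = 5e-6 ∧ chenHou_profileErrorBound = 1e-3 ∧ chenHou_exponentErrorBound = 5e-4 ∧
      0 < chenHou_Estar := by
  refine ⟨rfl, ?_, ?_, ?_⟩ <;> norm_num [chenHou_profileErrorBound, chenHou_exponentErrorBound,
    chenHou_Estar]

end Literature.Analysis.FluidPDE
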